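import Literature.Computability.QuantumComplexity.ZXCalculusLocalComp
import HarnessLib

/-!
# `ZX_{π/4}` modulo the calculus: colour swap is Hadamard conjugation, JPV Lemma 12 (control-π vs anti-CNOT) and JPV Lemma 11 (6-cycle bialgebra)

Topic `Literature/Computability/QuantumComplexity`, continuing `ZXCalculusLocalComp.lean`: layers A19, D3, D2 of the
formalisation of `JeandelPerdrixVilmart2018_completeness`, merged into one module. Three parts, each with its own header
below: (A19) `colorSwap_eq_conj`: the colour swap of any diagram is its conjugation by Hadamard tensors, derived by
induction on terms; (D3) the pure Euler form of `H`, the triangle, and **JPV Lemma 12** (`control_pi_anticnot_comm`);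
(D2) **JPV Lemma 11**, the hexagon (6-cycle) bialgebra identity (`hexagon_bialgebra`). With this module every lemma that
JPV's appendix asserts "by completeness of the π/2-fragment" (Lemmas 2–12) is derived inside `ZX_{π/4}` from Figure 1.
[cite: JeandelPerdrixVilmart2018, Appendix Lemmas 11, 12]
-/

/-! ## Part: `ZXCalculusColorSwap.lean` -/
/-!
# `ZX_{π/4}` modulo the calculus: the colour swap is conjugation by Hadamard boxes

Topic `Literature/Computability/QuantumComplexity`, continuing `ZXCalculusHadamardWires.lean`
(layer A19 of the formalisation of `JeandelPerdrixVilmart2018_completeness`).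

* `hTensor_add`: `H^{⊗(n+m)} = H^{⊗n} ⊗ H^{⊗m}` modulo the calculus;
* **`colorSwap_eq_conj`**: for EVERY diagram `D : n → m`, the colour-swapped diagram is the
  original conjugated by Hadamard boxes on all legs, `D^{cs} = H^{⊗n} ⨾ D ⨾ H^{⊗m}` — rule (H)
  extended from spiders to arbitrary diagrams by induction on the term (wires, crossing, cup, cap
  and the Hadamard box are fixed by both sides; compositions by the involutivity of `H^{⊗k}`).
  Consequently every identity of the calculus holds in Hadamard-conjugated form, and a diagram
  equals its colour swap exactly when it commutes with the Hadamard boxes on its boundary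
  (`colorSwap_eq_self_iff`).

## References

* E. Jeandel, S. Perdrix, R. Vilmart, LICS 2018 (arXiv:1705.11151v2), Fig. 1 rule (H) and §2.2
  ("the axioms are closed under colour swap") [JeandelPerdrixVilmart2018].
* B. Coecke, R. Duncan, New J. Phys. 13 (2011), §8 (colour change) [CoeckeDuncan2011].
-/

noncomputable section

namespace Literature.Computability.QuantumComplexity

open ZXDiagram ZXClass

namespace ZXClass

/-- `H^{⊗(n+m)} = H^{⊗n} ⊗ H^{⊗m}`. [folklore] -/
theorem hTensor_add (n : ℕ) : (m : ℕ) → mk (hTensor (n + m)) = mk (hTensor n) ⊠ mk (hTensor m)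
  | 0 => by rw [hTensor_zero, par_empty]; rfl
  | m + 1 => by
    rw [show hTensor (n + (m + 1)) = hTensor (n + m) ⊗ hBox from rfl, mk_par, hTensor_add n m, hTensor_succ]
    exact (par_assoc _ _ _).trans (cast_id _ _ _)

/-- **The colour swap is conjugation by Hadamard boxes**: `D^{cs} = H^{⊗n} ⨾ D ⨾ H^{⊗m}` for every
diagram `D : n → m`. [cite: JeandelPerdrixVilmart2018, Fig. 1 (H), §2.2] -/
theorem colorSwap_eq_conj : ∀ {n m : ℕ} (D : ZXDiagram n m),
    mk D.colorSwap = mk (hTensor n) ⨟ mk D ⨟ mk (hTensor m)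
  | _, _, wires k => by rw [colorSwap_wires, seq_id, hTensor_seq_hTensor]
  | _, _, ZXDiagram.swap => by
    have hHH : (mk hBox ⊠ mk hBox) ⨟ (mk hBox ⊠ mk hBox) = mk (wires 2) := by
      rw [interchange, hBox_seq_hBox, wires_par_wires]
    rw [colorSwap_swap, hTensor_two, seq_assoc, ← hBox_par_hBox_seq_swap, ← seq_assoc, hHH, id_seq]
  | _, _, ZXDiagram.cup => by rw [colorSwap_cup, hTensor_zero, id_seq, hTensor_two, cup_seq_hBox_par_hBox]
  | _, _, ZXDiagram.cap => by rw [colorSwap_cap, hTensor_two, hTensor_zero, seq_id, hBox_par_hBox_seq_cap]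
  | _, _, ZXDiagram.hBox => by rw [colorSwap_hBox, hTensor_one, hBox_seq_hBox, id_seq]
  | _, _, Z n m a => by rw [colorSwap_Z]; exact X_eq_conj n m a
  | _, _, X n m a => by rw [colorSwap_X]; exact Z_eq_conj n m a
  | _, _, ZXDiagram.seq (m := m) A B => by
    rw [ZXDiagram.colorSwap_seq, mk_seq, colorSwap_eq_conj A, colorSwap_eq_conj B, mk_seq, seq_assoc,
      ← seq_assoc (mk (hTensor m)) (mk (hTensor m) ⨟ mk B), ← seq_assoc (mk (hTensor m)) (mk (hTensor m)) (mk B),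
      hTensor_seq_hTensor, id_seq, ← seq_assoc, seq_assoc (mk (hTensor _)) (mk A) (mk B)]
  | _, _, ZXDiagram.par A B => by
    rw [ZXDiagram.colorSwap_par, mk_par, colorSwap_eq_conj A, colorSwap_eq_conj B, ← interchange, ← interchange,
      ← hTensor_add, ← hTensor_add, mk_par]

/-- The same for classes: `A^{cs} = H^{⊗n} ⨾ A ⨾ H^{⊗m}`. [cite: JeandelPerdrixVilmart2018, Fig. 1 (H)] -/
theorem colorSwap_eq_conj' {n m : ℕ} (A : ZXClass n m) : A.colorSwap = mk (hTensor n) ⨟ A ⨟ mk (hTensor m) := by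
  induction A using ZXClass.ind with
  | h D => exact colorSwap_eq_conj D

/-- Conjugating back: `H^{⊗n} ⨾ A^{cs} ⨾ H^{⊗m} = A`. [cite: JeandelPerdrixVilmart2018, Fig. 1 (H)] -/
theorem hTensor_seq_colorSwap_seq_hTensor {n m : ℕ} (A : ZXClass n m) :
    mk (hTensor n) ⨟ A.colorSwap ⨟ mk (hTensor m) = A := by
  rw [colorSwap_eq_conj', seq_assoc, seq_assoc, hTensor_seq_hTensor, seq_id, ← seq_assoc, hTensor_seq_hTensor, id_seq]

/-- A class equals its colour swap iff it commutes with the boundary Hadamard boxes: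
`A^{cs} = A ↔ H^{⊗n} ⨾ A = A ⨾ H^{⊗m}`. [cite: JeandelPerdrixVilmart2018, Fig. 1 (H)] -/
theorem colorSwap_eq_self_iff {n m : ℕ} (A : ZXClass n m) :
    A.colorSwap = A ↔ mk (hTensor n) ⨟ A = A ⨟ mk (hTensor m) := by
  rw [colorSwap_eq_conj']
  constructor
  · intro h
    have h' := congrArg (· ⨟ mk (hTensor m)) h
    simp only [seq_assoc, hTensor_seq_hTensor, seq_id] at h'
    exact h'
  · intro h
    rw [h, seq_assoc, hTensor_seq_hTensor, seq_id]

end ZXClass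

end Literature.Computability.QuantumComplexity


/-! ## Part: `ZXCalculusTriangle.lean` -/
/-!
# `ZX_{π/4}` modulo the calculus: the pure Euler decomposition; towards JPV Lemma 12

Topic `Literature/Computability/QuantumComplexity`, continuing `ZXCalculusLocalComp.lean` and
`ZXCalculusColorSwap.lean` (layer D.3 of the formalisation of `JeandelPerdrixVilmart2018_completeness`).

* **the Euler decomposition with phases only** (`hBox_eq_euler`):
  `H = (1/√2 ⊗ Z^{(0,0)}(-π/2)) ⊗ (Z(π/2) ⨾ X(π/2) ⨾ Z(π/2))` — rule (EU) with its green `-π/2`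
  state turned into the red `π/2` rotation (`par_Z_state_neg_two_seq_X_merge`), the scalar
  `e^{-iπ/4}` written `1/√2 ⊗ Z^{(0,0)}(-π/2)`.

(JPV Lemma 12 — control-`π` and anti-CNOT commute — is reduced in the notes to a one-Hadamard
identity on the triangle of Lemma 10; its derivation continues in this file.)

## References

* E. Jeandel, S. Perdrix, R. Vilmart, LICS 2018 (arXiv:1705.11151v2), Fig. 1 (EU) and Appendix
  Lemma 12 [JeandelPerdrixVilmart2018].
-/

noncomputable section

namespace Literature.Computability.QuantumComplexity

open ZXDiagram ZXClass

namespace ZXClass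

/-! ### The pure Euler decomposition -/

/-- A scalar inside `𝕀 ⊗ ·` in front of a state. [folklore] -/
theorem wires_par_scalar_par_state (s : ZXClass 0 0) (B : ZXClass 0 1) :
    mk (wires 1) ⊠ (s ⊠ B) = s ⊠ (mk (wires 1) ⊠ B) := by
  rw [par_assoc', cast_id, ← scalar_par_wires]
  exact (par_assoc _ _ _).trans (cast_id _ _ _)

/-- A scalar in front of a `1 → 2` map stays in front when a map to one wire is appended. [folklore] -/
theorem scalar_par_one_two_seq_one (s : ZXClass 0 0) (A : ZXClass 1 2) (B : ZXClass 2 1) :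
    (s ⊠ A) ⨟ B = s ⊠ (A ⨟ B) := by
  rw [scalar_par_seq_left, empty_par, cast_id]

/-- **The green `-π/2` state on a red merge is the red `π/2` rotation** (up to `e^{-iπ/4}`):
`(𝕀 ⊗ Z^{(0,1)}(-π/2)) ⨾ X^{(2,1)} = 1/√2 ⊗ Z^{(0,0)}(-π/2) ⊗ X(π/2)`. [cite: JeandelPerdrixVilmart2018, Fig. 1 (EU)] -/
theorem par_Z_state_neg_two_seq_X_merge :
    (mk (wires 1) ⊠ mk (Z 0 1 (-2))) ⨟ mk (X 2 1 0) = mk invSqrtTwo ⊠ (mk (Z 0 0 (-2)) ⊠ mk (X 1 1 2)) := by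
  rw [Z_state_neg_two, wires_par_scalar_par_state, wires_par_scalar_par_state, scalar_par_one_two_seq_one,
    scalar_par_one_two_seq_one, par_X_seq_X 1 0 1 1 le_rfl, zero_add (2 : ZMod 8)]

/-- **The Euler decomposition with phases only**: `H = (1/√2 ⊗ Z^{(0,0)}(-π/2)) ⊗ (Z(π/2) ⨾ X(π/2) ⨾ Z(π/2))`.
[cite: JeandelPerdrixVilmart2018, Fig. 1 (EU)] -/
theorem hBox_eq_euler :
    mk hBox = mk invSqrtTwo ⊠ (mk (Z 0 0 (-2)) ⊠ (mk (Z 1 1 2) ⨟ mk (X 1 1 2) ⨟ mk (Z 1 1 2))) := by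
  rw [rule_EU, par_eq_seq_left (mk (Z 1 1 2)) (mk (Z 0 1 (-2))), par_empty, seq_assoc (mk (Z 1 1 2)),
    par_Z_state_neg_two_seq_X_merge, seq_scalar_par_one, seq_scalar_par_one, scalar_par_seq_one, scalar_par_seq_one]

/-! ### The one-Hadamard identity behind Lemma 12 -/

/-- `H ⨾ X(a) = Z(a) ⨾ H`. [cite: JeandelPerdrixVilmart2018, Fig. 1 (H)] -/
theorem hBox_seq_X_phase (a : ZMod 8) : mk hBox ⨟ mk (X 1 1 a) = mk (Z 1 1 a) ⨟ mk hBox := (Z_phase_seq_hBox a).symm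

/-- The single-wire tail of the one-Hadamard identity: `X(-π/2) ⨾ Z(π) ⨾ H ⨾ X(π/2) = e^{-iπ/4} Z(π/2)`,
the scalar written `1/√2 ⊗ Z^{(0,0)}(-π/2)`. [cite: JeandelPerdrixVilmart2018, Fig. 1 (EU)] -/
theorem xphase_seq_Z_pi_seq_hBox_seq_xphase :
    mk (X 1 1 (-2)) ⨟ mk (Z 1 1 4) ⨟ mk hBox ⨟ mk (X 1 1 2) = mk invSqrtTwo ⊠ (mk (Z 0 0 (-2)) ⊠ mk (Z 1 1 2)) := by
  rw [seq_assoc _ (mk hBox), hBox_seq_X_phase, ← seq_assoc, seq_assoc (mk (X 1 1 (-2))), phase_seq_phase, hBox_eq_euler,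
    seq_scalar_par_one, seq_scalar_par_one, ← seq_assoc, ← seq_assoc, seq_assoc (mk (X 1 1 (-2))), phase_seq_phase,
    show (4 : ZMod 8) + 2 + 2 = 0 from by decide, Z_one_one, seq_id, xphase_seq_xphase, neg_add_cancel, X_one_one, id_seq]

/-- `Z(π/2) ⨾ H = e^{-iπ/4} (Z(π) ⨾ X(π/2) ⨾ Z(π/2))`. [cite: JeandelPerdrixVilmart2018, Fig. 1 (EU)] -/
theorem Z_halfpi_seq_hBox :
    mk (Z 1 1 2) ⨟ mk hBox = mk invSqrtTwo ⊠ (mk (Z 0 0 (-2)) ⊠ (mk (Z 1 1 4) ⨟ mk (X 1 1 2) ⨟ mk (Z 1 1 2))) := by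
  rw [hBox_eq_euler, seq_scalar_par_one, seq_scalar_par_one, ← seq_assoc, ← seq_assoc, phase_seq_phase,
    show (2 : ZMod 8) + 2 = 4 from by decide]

/-- A scalar passes a `2 → 1` map into the `1 → 1` map after it. [folklore] -/
theorem two_one_seq_scalar_par_one (A : ZXClass 2 1) (s : ZXClass 0 0) (B : ZXClass 1 1) :
    A ⨟ (s ⊠ B) = s ⊠ (A ⨟ B) := by
  rw [scalar_par_seq_right, empty_par, cast_id]

/-- A scalar inside `𝕀 ⊗ ·` (arity `1 → 1` inside) followed by a merge. [folklore] -/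
theorem par_scalar_par_seq_merge (s : ZXClass 0 0) (W : ZXClass 1 1) (B : ZXClass 2 1) :
    (mk (wires 1) ⊠ (s ⊠ W)) ⨟ B = s ⊠ ((mk (wires 1) ⊠ W) ⨟ B) := by
  rw [← scalar_par_wires_par_one, scalar_par_seq_left, empty_par, cast_id]

/-- **The one-Hadamard identity**: a Hadamard box on one input of the green merge, probed by
`X(π/2)`: `(𝕀 ⊗ (H ⨾ X(π/2))) ⨾ Z^{(2,1)} = (𝕀 ⊗ (Z(π) ⨾ X(π/2))) ⨾ Z^{(2,1)} ⨾ X(-π/2) ⨾ Z(π) ⨾ H ⨾ X(π/2)`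
— both sides are `e^{-iπ/4} ((𝕀 ⊗ (Z(π) ⨾ X(π/2))) ⨾ Z^{(2,1)} ⨾ Z(π/2))` by the Euler rule.
[cite: JeandelPerdrixVilmart2018, Fig. 1 (EU), Appendix Lemma 12] -/
theorem par_hBox_xhalfpi_seq_merge :
    (mk (wires 1) ⊠ (mk hBox ⨟ mk (X 1 1 2))) ⨟ mk (Z 2 1 0) =
      (mk (wires 1) ⊠ (mk (Z 1 1 4) ⨟ mk (X 1 1 2))) ⨟ mk (Z 2 1 0) ⨟ mk (X 1 1 (-2)) ⨟ mk (Z 1 1 4) ⨟ mk hBox ⨟ mk (X 1 1 2) := by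
  have hL : (mk (wires 1) ⊠ (mk hBox ⨟ mk (X 1 1 2))) ⨟ mk (Z 2 1 0) =
      mk invSqrtTwo ⊠ (mk (Z 0 0 (-2)) ⊠ (((mk (wires 1) ⊠ (mk (Z 1 1 4) ⨟ mk (X 1 1 2))) ⨟ mk (Z 2 1 0)) ⨟ mk (Z 1 1 2))) := by
    rw [hBox_seq_X_phase, Z_halfpi_seq_hBox, par_scalar_par_seq_merge, par_scalar_par_seq_merge, wires_par_seq, seq_assoc,
      par_Z_seq_Z 1 1 1 1 le_rfl, zero_add (2 : ZMod 8),
      show mk (Z (1 + 1) 1 2) = mk (Z 2 1 0) ⨟ mk (Z 1 1 2) from by rw [Z_seq_Z 2 1 1 le_rfl, zero_add], ← seq_assoc]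
  have hR : (mk (wires 1) ⊠ (mk (Z 1 1 4) ⨟ mk (X 1 1 2))) ⨟ mk (Z 2 1 0) ⨟ mk (X 1 1 (-2)) ⨟ mk (Z 1 1 4) ⨟ mk hBox ⨟ mk (X 1 1 2) =
      mk invSqrtTwo ⊠ (mk (Z 0 0 (-2)) ⊠ (((mk (wires 1) ⊠ (mk (Z 1 1 4) ⨟ mk (X 1 1 2))) ⨟ mk (Z 2 1 0)) ⨟ mk (Z 1 1 2))) := by
    rw [seq_assoc _ (mk (X 1 1 (-2))), seq_assoc _ (mk (X 1 1 (-2)) ⨟ mk (Z 1 1 4)), seq_assoc _ (mk (X 1 1 (-2)) ⨟ mk (Z 1 1 4) ⨟ mk hBox),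
      xphase_seq_Z_pi_seq_hBox_seq_xphase, two_one_seq_scalar_par_one, two_one_seq_scalar_par_one]
  exact hL.trans hR.symm

/-! ### JPV Lemma 12: control-`π` and anti-CNOT commute -/

/-- `√2` cancels on the left of any class (here `2 → 1`). [cite: JeandelPerdrixVilmart2018, Appendix Lemma 5] -/
theorem cancel_sqrt_two_two_one {A B : ZXClass 2 1} (h : mk (dumbbell 0 0) ⊠ A = mk (dumbbell 0 0) ⊠ B) : A = B := by
  have h' := congrArg (mk invSqrtTwo ⊠ ·) h
  rwa [par_assoc', cast_id, par_assoc', cast_id, scalar_par_comm (mk invSqrtTwo), inverse_rule, empty_par, cast_id,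
    empty_par, cast_id] at h'

/-- The Hadamard wire followed by `(𝕀 ⊗ H) ⨾ (H ⊗ 𝕀) ⨾ Z^{(2,1)}` is the triangle of Lemma 10:
`CZ ⨾ (𝕀 ⊗ H) ⨾ (H ⊗ 𝕀) ⨾ Z^{(2,1)} = T`. [cite: JeandelPerdrixVilmart2018, Appendix Lemma 10] -/
theorem hWire_seq_eq_triangle :
    ((mk (Z 1 2 0) ⊠ mk (wires 1)) ⨟ ((mk (wires 1) ⊠ mk hBox) ⊠ mk (wires 1)) ⨟ (mk (wires 1) ⊠ mk (Z 2 1 0))) ⨟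
        (mk (wires 1) ⊠ mk hBox) ⨟ (mk hBox ⊠ mk (wires 1)) ⨟ mk (Z 2 1 0) =
      ((mk (Z 1 2 0) ⨟ (mk hBox ⊠ mk hBox)) ⊠ mk (wires 1)) ⨟ (mk (wires 1) ⊠ mk (Z 2 1 0)) ⨟ (mk (wires 1) ⊠ mk hBox) ⨟ mk (Z 2 1 0) := by
  have e : mk hBox ⊠ mk (wires 2) = (mk hBox ⊠ mk (wires 1)) ⊠ mk (wires 1) := by
    rw [← wires_par_wires 1 1]; exact (par_assoc' _ _ _).trans (cast_id _ _ _)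
  rw [seq_assoc _ (mk (wires 1) ⊠ mk hBox) (mk hBox ⊠ mk (wires 1)), ← par_eq_seq_right, par_eq_seq_left (mk hBox) (mk hBox),
    ← seq_assoc _ (mk hBox ⊠ mk (wires 1)) (mk (wires 1) ⊠ mk hBox), seq_assoc _ (mk (wires 1) ⊠ mk (Z 2 1 0)) (mk hBox ⊠ mk (wires 1)),
    ← par_eq_seq_right, par_eq_seq_left (mk hBox) (mk (Z 2 1 0)), ← seq_assoc _ (mk hBox ⊠ mk (wires 2)) (mk (wires 1) ⊠ mk (Z 2 1 0)),
    seq_assoc (mk (Z 1 2 0) ⊠ mk (wires 1)) _ (mk hBox ⊠ mk (wires 2)), e, interchange (mk (wires 1) ⊠ mk hBox) (mk hBox ⊠ mk (wires 1)),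
    ← par_eq_seq_right, id_seq, ← seq_par_wires, ← par_eq_seq_left]

/-- **Lemma 12's left-hand side through the triangle**: `(X^{(1,2)} ⊗ 𝕀) ⨾ (𝕀 ⊗ ((H ⊗ 𝕀) ⨾ X^{(2,1)})) ⨾ Z^{(2,1)}(π)
= (H ⊗ H) ⨾ T ⨾ Z(π)` for the triangle `T` of Lemma 10. [cite: JeandelPerdrixVilmart2018, Appendix Lemma 12] -/
theorem lemma12_lhs_eq :
    (mk (X 1 2 0) ⊠ mk (wires 1)) ⨟ (mk (wires 1) ⊠ ((mk hBox ⊠ mk (wires 1)) ⨟ mk (X 2 1 0))) ⨟ mk (Z 2 1 4) =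
      (mk hBox ⊠ mk hBox) ⨟ (((mk (Z 1 2 0) ⨟ (mk hBox ⊠ mk hBox)) ⊠ mk (wires 1)) ⨟ (mk (wires 1) ⊠ mk (Z 2 1 0)) ⨟
        (mk (wires 1) ⊠ mk hBox) ⨟ mk (Z 2 1 0)) ⨟ mk (Z 1 1 4) := by
  have hZ : (mk hBox ⊠ mk hBox) ⨟ mk (Z 2 1 4) =
      (((mk (wires 1) ⊠ mk hBox) ⨟ (mk hBox ⊠ mk (wires 1))) ⨟ mk (Z 2 1 0)) ⨟ mk (Z 1 1 4) := by
    rw [← par_eq_seq_right, seq_assoc, Z_seq_Z 2 1 1 le_rfl, zero_add]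
  set cz := (mk (Z 1 2 0) ⊠ mk (wires 1)) ⨟ ((mk (wires 1) ⊠ mk hBox) ⊠ mk (wires 1)) ⨟ (mk (wires 1) ⊠ mk (Z 2 1 0)) with hcz
  rw [xsplits_hWire_eq_conj, ← hcz, seq_assoc _ (mk hBox ⊠ mk hBox) (mk (Z 2 1 4)), hZ, ← seq_assoc _ _ (mk (Z 1 1 4)),
    seq_assoc (mk hBox ⊠ mk hBox) cz, ← seq_assoc cz, ← seq_assoc cz, hcz, hWire_seq_eq_triangle]

/-- **Lemma 12's right-hand side through the triangle**:
`(X^{(1,2)} ⊗ Z^{(1,2)}(π)) ⨾ (𝕀 ⊗ ε ⊗ 𝕀) ⨾ (H ⊗ 𝕀) ⨾ X^{(2,1)} = (H ⊗ Z(π)) ⨾ T ⨾ H`. [cite: JeandelPerdrixVilmart2018, Appendix Lemma 12] -/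
theorem lemma12_rhs_eq :
    (mk (X 1 2 0) ⊠ mk (Z 1 2 4)) ⨟ ((mk (wires 1) ⊠ mk cap) ⊠ mk (wires 1)) ⨟ (mk hBox ⊠ mk (wires 1)) ⨟ mk (X 2 1 0) =
      (mk hBox ⊠ mk (Z 1 1 4)) ⨟ (((mk (Z 1 2 0) ⨟ (mk hBox ⊠ mk hBox)) ⊠ mk (wires 1)) ⨟ (mk (wires 1) ⊠ mk (Z 2 1 0)) ⨟
        (mk (wires 1) ⊠ mk hBox) ⨟ mk (Z 2 1 0)) ⨟ mk hBox := by
  have hb : (mk (wires 1) ⊠ mk (Z 1 2 4)) ⨟ (mk cap ⊠ mk (wires 1)) = mk (Z 2 1 4) := by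
    simpa using Z_bend_cap 1 1 4
  have e1 : mk (wires 2) ⊠ mk (Z 1 2 4) = mk (wires 1) ⊠ (mk (wires 1) ⊠ mk (Z 1 2 4)) := by
    rw [← wires_par_wires 1 1]; exact (par_assoc _ _ _).trans (cast_id _ _ _)
  have e2 : (mk (wires 1) ⊠ mk cap) ⊠ mk (wires 1) = mk (wires 1) ⊠ (mk cap ⊠ mk (wires 1)) := (par_assoc _ _ _).trans (cast_id _ _ _)
  have h1 : (mk (X 1 2 0) ⊠ mk (Z 1 2 4)) ⨟ ((mk (wires 1) ⊠ mk cap) ⊠ mk (wires 1)) =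
      (mk (X 1 2 0) ⊠ mk (wires 1)) ⨟ (mk (wires 1) ⊠ mk (Z 2 1 4)) := by
    rw [par_eq_seq_left (mk (X 1 2 0)) (mk (Z 1 2 4)), seq_assoc, e1, e2, ← wires_par_seq, hb]
  have h2 : (mk hBox ⊠ mk (wires 1)) ⨟ mk (X 2 1 0) = (mk (wires 1) ⊠ mk hBox) ⨟ mk (Z 2 1 0) ⨟ mk hBox := by
    rw [X_merge_eq, ← seq_assoc, ← seq_assoc, interchange, hBox_seq_hBox, id_seq]
  have hZ : mk (Z 2 1 4) = (mk (wires 1) ⊠ mk (Z 1 1 4)) ⨟ mk (Z 2 1 0) := by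
    rw [par_Z_seq_Z 1 1 1 1 le_rfl, zero_add]
  calc (mk (X 1 2 0) ⊠ mk (Z 1 2 4)) ⨟ ((mk (wires 1) ⊠ mk cap) ⊠ mk (wires 1)) ⨟ (mk hBox ⊠ mk (wires 1)) ⨟ mk (X 2 1 0)
      = ((mk (X 1 2 0) ⊠ mk (wires 1)) ⨟ (mk (wires 1) ⊠ mk (Z 2 1 4))) ⨟ ((mk (wires 1) ⊠ mk hBox) ⨟ mk (Z 2 1 0)) ⨟ mk hBox := by
        rw [h1, seq_assoc _ (mk hBox ⊠ mk (wires 1)) (mk (X 2 1 0)), h2, ← seq_assoc _ _ (mk hBox)]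
    _ = ((mk hBox ⊠ mk (wires 1)) ⨟ ((mk (Z 1 2 0) ⨟ (mk hBox ⊠ mk hBox)) ⊠ mk (wires 1)) ⨟ (mk (wires 2) ⊠ mk (Z 1 1 4)) ⨟
          (mk (wires 1) ⊠ mk (Z 2 1 0))) ⨟ ((mk (wires 1) ⊠ mk hBox) ⨟ mk (Z 2 1 0)) ⨟ mk hBox := by
        rw [X_split_eq, seq_par_wires, seq_par_wires, hZ, wires_par_seq, ← seq_assoc _ (mk (wires 1) ⊠ (mk (wires 1) ⊠ mk (Z 1 1 4))),
          seq_assoc (mk hBox ⊠ mk (wires 1)) (mk (Z 1 2 0) ⊠ mk (wires 1)), ← seq_par_wires,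
          show mk (wires 1) ⊠ (mk (wires 1) ⊠ mk (Z 1 1 4)) = mk (wires 2) ⊠ mk (Z 1 1 4) from by
            rw [← wires_par_wires 1 1]; exact (par_assoc' _ _ _).trans (cast_id _ _ _),
          seq_assoc (mk hBox ⊠ mk (wires 1))]
    _ = (mk hBox ⊠ mk (Z 1 1 4)) ⨟ (((mk (Z 1 2 0) ⨟ (mk hBox ⊠ mk hBox)) ⊠ mk (wires 1)) ⨟ (mk (wires 1) ⊠ mk (Z 2 1 0)) ⨟
          (mk (wires 1) ⊠ mk hBox) ⨟ mk (Z 2 1 0)) ⨟ mk hBox := by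
        rw [seq_assoc (mk hBox ⊠ mk (wires 1)) ((mk (Z 1 2 0) ⨟ (mk hBox ⊠ mk hBox)) ⊠ mk (wires 1)) (mk (wires 2) ⊠ mk (Z 1 1 4)),
          slide, ← seq_assoc (mk hBox ⊠ mk (wires 1)) (mk (wires 1) ⊠ mk (Z 1 1 4)), ← par_eq_seq_left,
          seq_assoc (mk hBox ⊠ mk (Z 1 1 4)) ((mk (Z 1 2 0) ⨟ (mk hBox ⊠ mk hBox)) ⊠ mk (wires 1)) (mk (wires 1) ⊠ mk (Z 2 1 0)),
          seq_assoc (mk hBox ⊠ mk (Z 1 1 4)) _ ((mk (wires 1) ⊠ mk hBox) ⨟ mk (Z 2 1 0)),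
          ← seq_assoc _ (mk (wires 1) ⊠ mk hBox) (mk (Z 2 1 0))]

/-- **The triangle with one `√2`**: `√2 ⊗ T = (X(π/2) ⊗ X(π/2)) ⨾ Z^{(2,1)} ⨾ X(-π/2) ⨾ Z(π)` (Lemma 10,
its `X(π/2)` and `Z(π)` inverted). [cite: JeandelPerdrixVilmart2018, Appendix Lemma 10] -/
theorem sqrt_two_par_triangle :
    mk (dumbbell 0 0) ⊠ (((mk (Z 1 2 0) ⨟ (mk hBox ⊠ mk hBox)) ⊠ mk (wires 1)) ⨟ (mk (wires 1) ⊠ mk (Z 2 1 0)) ⨟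
        (mk (wires 1) ⊠ mk hBox) ⨟ mk (Z 2 1 0)) =
      (mk (X 1 1 2) ⊠ mk (X 1 1 2)) ⨟ mk (Z 2 1 0) ⨟ mk (X 1 1 (-2)) ⨟ mk (Z 1 1 4) := by
  rw [X_halfpis_seq_Z_merge, scalar_par_two_one_seq_one, scalar_par_two_one_seq_one]
  congr 1
  rw [seq_assoc _ (mk (X 1 1 2)) (mk (X 1 1 (-2))), xphase_seq_xphase, add_neg_cancel, X_one_one, seq_id,
    seq_assoc _ (mk (Z 2 1 4)) (mk (Z 1 1 4)), Z_seq_Z 2 1 1 le_rfl, show (4 : ZMod 8) + 4 = 0 from by decide]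

/-- **JPV Lemma 12** (control-`π` and anti-CNOT commute): two red nodes on the two inputs joined by a
Hadamard wire, both plugged into a green `π` node carrying the output, equal the diagram where the
second input enters the green `π` node and the output leaves the second red node:
`(X^{(1,2)} ⊗ 𝕀) ⨾ (𝕀 ⊗ ((H ⊗ 𝕀) ⨾ X^{(2,1)})) ⨾ Z^{(2,1)}(π) = (X^{(1,2)} ⊗ Z^{(1,2)}(π)) ⨾ (𝕀 ⊗ ε ⊗ 𝕀) ⨾ (H ⊗ 𝕀) ⨾ X^{(2,1)}`.
Derivation (ours): both sides are the triangle of Lemma 10 with boundary Hadamard boxes and a `π`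
(`lemma12_lhs_eq`, `lemma12_rhs_eq`); with one `√2` the triangle is `(X(π/2) ⊗ X(π/2)) ⨾ Z^{(2,1)} ⨾ …`
(Lemma 10), and the two sides then differ exactly by the one-Hadamard identity of the Euler rule
(`par_hBox_xhalfpi_seq_merge`). [cite: JeandelPerdrixVilmart2018, Appendix Lemma 12] -/
theorem control_pi_anticnot_comm :
    (mk (X 1 2 0) ⊠ mk (wires 1)) ⨟ (mk (wires 1) ⊠ ((mk hBox ⊠ mk (wires 1)) ⨟ mk (X 2 1 0))) ⨟ mk (Z 2 1 4) =
      (mk (X 1 2 0) ⊠ mk (Z 1 2 4)) ⨟ ((mk (wires 1) ⊠ mk cap) ⊠ mk (wires 1)) ⨟ (mk hBox ⊠ mk (wires 1)) ⨟ mk (X 2 1 0) := by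
  apply cancel_sqrt_two_two_one
  rw [lemma12_lhs_eq, lemma12_rhs_eq]
  conv_lhs => rw [← scalar_par_two_one_seq_one, ← two_two_seq_scalar_par_one, sqrt_two_par_triangle]
  conv_rhs => rw [← scalar_par_two_one_seq_one, ← two_two_seq_scalar_par_one, sqrt_two_par_triangle]
  set P := (mk hBox ⨟ mk (X 1 1 2)) ⊠ mk (wires 1)
  set Y := (((((mk (wires 1) ⊠ (mk (Z 1 1 4) ⨟ mk (X 1 1 2))) ⨟ mk (Z 2 1 0)) ⨟ mk (X 1 1 (-2))) ⨟ mk (Z 1 1 4)) ⨟ mk hBox)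
  have hL : ((mk hBox ⊠ mk hBox) ⨟ ((mk (X 1 1 2) ⊠ mk (X 1 1 2)) ⨟ mk (Z 2 1 0) ⨟ mk (X 1 1 (-2)) ⨟ mk (Z 1 1 4))) ⨟ mk (Z 1 1 4) = P ⨟ Y := by
    rw [seq_assoc, seq_assoc _ (mk (Z 1 1 4)) (mk (Z 1 1 4)), phase_seq_phase, show (4 : ZMod 8) + 4 = 0 from by decide, Z_one_one,
      seq_id, ← seq_assoc, ← seq_assoc, interchange, par_eq_seq_left (mk hBox ⨟ mk (X 1 1 2)) (mk hBox ⨟ mk (X 1 1 2)),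
      seq_assoc P, par_hBox_xhalfpi_seq_merge, seq_assoc P, seq_assoc _ (mk (X 1 1 2)) (mk (X 1 1 (-2))), xphase_seq_xphase,
      add_neg_cancel, X_one_one, seq_id]
  have hR : ((mk hBox ⊠ mk (Z 1 1 4)) ⨟ ((mk (X 1 1 2) ⊠ mk (X 1 1 2)) ⨟ mk (Z 2 1 0) ⨟ mk (X 1 1 (-2)) ⨟ mk (Z 1 1 4))) ⨟ mk hBox = P ⨟ Y := by
    rw [← seq_assoc, ← seq_assoc, ← seq_assoc, interchange, par_eq_seq_left (mk hBox ⨟ mk (X 1 1 2)) (mk (Z 1 1 4) ⨟ mk (X 1 1 2)),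
      seq_assoc P, seq_assoc P, seq_assoc P, seq_assoc P]
  exact hL.trans hR.symm

end ZXClass

end Literature.Computability.QuantumComplexity


/-! ## Part: `ZXCalculusHexagon.lean` -/
/-!
# `ZX_{π/4}` modulo the calculus: towards JPV Lemma 11 (the 6-cycle bialgebra)

Topic `Literature/Computability/QuantumComplexity`, continuing `ZXCalculusLadder.lean` (layer D.2
of the formalisation of `JeandelPerdrixVilmart2018_completeness`).

JPV Lemma 11: the alternating hexagon `g₀–r₂–g₄–r₃–g₅–r₁–g₀` with the three inputs on
`r₂, g₀, r₁` and the three outputs on `g₄, r₃, g₅` equals the alternating "crown" hexagon with the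
inputs on three green nodes and the outputs on three red nodes. In term form (ours):
`((𝕀 ⊗ Z^{(1,2)}) ⊗ 𝕀) ⨾ (X^{(2,1)} ⊗ X^{(2,1)}) ⨾ (Z^{(1,2)} ⊗ Z^{(1,2)}) ⨾ ((𝕀 ⊗ X^{(2,1)}) ⊗ 𝕀)
 = ((Z^{(1,2)} ⊗ Z^{(1,2)}) ⊗ Z^{(1,2)}) ⨾ ((𝕀 ⊗ σ) ⊗ (σ ⊗ 𝕀)) ⨾ ((X^{(2,1)} ⊗ X^{(2,1)}) ⊗ X^{(2,1)})`.
Our derivation reads JPV's proof figure backwards: the two middle `X^{(2,1)} ⨾ Z^{(1,2)}` are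
expanded by (B2) (`hexagon_lhs_eq_sqrt_two_sq_par`, this file's first step), the centre nodes fuse
with the inner ones, the resulting double edge is removed by the Hopf law, and what remains is the
crown.

## References

* E. Jeandel, S. Perdrix, R. Vilmart, LICS 2018 (arXiv:1705.11151v2), Appendix Lemma 11 and its
  proof figure `6-cycle-bialgebra-proof` [JeandelPerdrixVilmart2018].
-/

noncomputable section

namespace Literature.Computability.QuantumComplexity

open ZXDiagram ZXClass

namespace ZXClass

/-- `t ⊗ 𝕀² = 𝕀² ⊗ t` for a scalar `t`. [folklore] -/
theorem scalar_par_wires_two (t : ZXClass 0 0) : t ⊠ mk (wires 2) = mk (wires 2) ⊠ t := by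
  rw [← wires_par_wires 1 1, par_assoc', cast_id, scalar_par_wires, par_assoc, cast_id, scalar_par_wires]
  exact (par_assoc' _ _ _).trans (cast_id _ _ _)

/-- A scalar commutes past a `2 → 2` map: `t ⊗ A = A ⊗ t`. [folklore] -/
theorem scalar_par_two_two_comm (t : ZXClass 0 0) (A : ZXClass 2 2) : t ⊠ A = A ⊠ t := by
  calc t ⊠ A = (t ⊠ mk (wires 2)) ⨟ (mk (wires 0) ⊠ A) := by rw [par_eq_seq_left]
    _ = (mk (wires 2) ⊠ t) ⨟ (mk (wires 0) ⊠ A) := by rw [scalar_par_wires_two]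
    _ = A ⊠ t := by rw [empty_par, cast_id, par_eq_seq_right A t, par_empty]

/-- Two scalars in front of two parallel `2 → 2` maps come out in front. [folklore] -/
theorem scalar_par_two_two_par_scalar_par_two_two (s t : ZXClass 0 0) (A B : ZXClass 2 2) :
    (s ⊠ A) ⊠ (t ⊠ B) = s ⊠ (t ⊠ (A ⊠ B)) := by
  rw [par_assoc, cast_id, par_assoc' A t B, cast_id, ← scalar_par_two_two_comm t A, par_assoc t A B, cast_id]

/-- A scalar passes a `3 → 4` map (instance of `scalar_par_seq_right`). [folklore] -/
theorem three_four_seq_scalar_par (A : ZXClass 3 4) (s : ZXClass 0 0) (B : ZXClass 4 4) :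
    A ⨟ (s ⊠ B) = s ⊠ (A ⨟ B) := by
  rw [scalar_par_seq_right, empty_par, cast_id]

/-- A scalar in front of a `3 → 4` map stays in front (instance of `scalar_par_seq_left`). [folklore] -/
theorem scalar_par_three_four_seq (s : ZXClass 0 0) (A : ZXClass 3 4) (B : ZXClass 4 3) :
    (s ⊠ A) ⨟ B = s ⊠ (A ⨟ B) := by
  rw [scalar_par_seq_left, empty_par, cast_id]

/-- **Step 1 of Lemma 11**: the two middle `X^{(2,1)} ⨾ Z^{(1,2)}` expanded by (B2):
`LHS₁₁ = √2 ⊗ √2 ⊗ (((𝕀 ⊗ Z^{(1,2)}) ⊗ 𝕀) ⨾ (B ⊗ B) ⨾ ((𝕀 ⊗ X^{(2,1)}) ⊗ 𝕀))` with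
`B := (Z^{(1,2)} ⊗ Z^{(1,2)}) ⨾ (𝕀 ⊗ σ ⊗ 𝕀) ⨾ (X^{(2,1)} ⊗ X^{(2,1)})`. [cite: JeandelPerdrixVilmart2018, Fig. 1 (B2), Appendix Lemma 11] -/
theorem hexagon_lhs_eq_sqrt_two_sq_par :
    ((mk (wires 1) ⊠ mk (Z 1 2 0)) ⊠ mk (wires 1)) ⨟ (mk (X 2 1 0) ⊠ mk (X 2 1 0)) ⨟ (mk (Z 1 2 0) ⊠ mk (Z 1 2 0)) ⨟
        ((mk (wires 1) ⊠ mk (X 2 1 0)) ⊠ mk (wires 1)) =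
      mk (dumbbell 0 0) ⊠ (mk (dumbbell 0 0) ⊠ (((mk (wires 1) ⊠ mk (Z 1 2 0)) ⊠ mk (wires 1)) ⨟
        (((mk (Z 1 2 0) ⊠ mk (Z 1 2 0)) ⨟ ((mk (wires 1) ⊠ mk swap) ⊠ mk (wires 1)) ⨟ (mk (X 2 1 0) ⊠ mk (X 2 1 0))) ⊠
         ((mk (Z 1 2 0) ⊠ mk (Z 1 2 0)) ⨟ ((mk (wires 1) ⊠ mk swap) ⊠ mk (wires 1)) ⨟ (mk (X 2 1 0) ⊠ mk (X 2 1 0)))) ⨟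
        ((mk (wires 1) ⊠ mk (X 2 1 0)) ⊠ mk (wires 1)))) := by
  rw [seq_assoc _ (mk (X 2 1 0) ⊠ mk (X 2 1 0)) (mk (Z 1 2 0) ⊠ mk (Z 1 2 0)), interchange, ← rule_B2,
    scalar_par_two_two_par_scalar_par_two_two, three_four_seq_scalar_par, three_four_seq_scalar_par,
    scalar_par_three_four_seq, scalar_par_three_four_seq]

/-! ### Step 2a: fusing the centre nodes into the expanded middles -/

/-- `Z^{(1,2)} ⨾ (Z^{(1,2)} ⊗ Z^{(1,2)}) = Z^{(1,4)}`. [cite: JeandelPerdrixVilmart2018, Fig. 1 (S1)] -/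
theorem Z_split_seq_splits : mk (Z 1 2 0) ⨟ (mk (Z 1 2 0) ⊠ mk (Z 1 2 0)) = mk (Z 1 4 0) := by
  rw [par_eq_seq_left (mk (Z 1 2 0)) (mk (Z 1 2 0)), ← seq_assoc, Z_seq_Z_par 1 1 1 2 le_rfl, add_zero (0 : ZMod 8),
    Z_seq_par_Z 1 2 1 2 le_rfl, add_zero (0 : ZMod 8)]

/-- `(X^{(2,1)} ⊗ X^{(2,1)}) ⨾ X^{(2,1)} = X^{(4,1)}`. [cite: JeandelPerdrixVilmart2018, Fig. 1 (S1)] -/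
theorem xmerges_seq_xmerge : (mk (X 2 1 0) ⊠ mk (X 2 1 0)) ⨟ mk (X 2 1 0) = mk (X 4 1 0) := by
  have h := congrArg (fun A => (transpose A).colorSwap) Z_split_seq_splits
  simpa using h

/-- **Fusing the centre green node**: `((𝕀 ⊗ Z^{(1,2)}) ⊗ 𝕀) ⨾ ((Z^{(1,2)} ⊗ Z^{(1,2)}) ⊗ (Z^{(1,2)} ⊗ Z^{(1,2)}))
= (Z^{(1,2)} ⊗ Z^{(1,4)}) ⊗ Z^{(1,2)}`. [cite: JeandelPerdrixVilmart2018, Fig. 1 (S1)] -/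
theorem top_seq_splits :
    ((mk (wires 1) ⊠ mk (Z 1 2 0)) ⊠ mk (wires 1)) ⨟ ((mk (Z 1 2 0) ⊠ mk (Z 1 2 0)) ⊠ (mk (Z 1 2 0) ⊠ mk (Z 1 2 0))) =
      (mk (Z 1 2 0) ⊠ mk (Z 1 4 0)) ⊠ mk (Z 1 2 0) := by
  have e : (mk (Z 1 2 0) ⊠ mk (Z 1 2 0)) ⊠ (mk (Z 1 2 0) ⊠ mk (Z 1 2 0)) =
      (mk (Z 1 2 0) ⊠ (mk (Z 1 2 0) ⊠ mk (Z 1 2 0))) ⊠ mk (Z 1 2 0) := by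
    rw [show (mk (Z 1 2 0) ⊠ (mk (Z 1 2 0) ⊠ mk (Z 1 2 0))) = (mk (Z 1 2 0) ⊠ mk (Z 1 2 0)) ⊠ mk (Z 1 2 0)
      from (par_assoc' _ _ _).trans (cast_id _ _ _)]
    exact (par_assoc' _ _ _).trans (cast_id _ _ _)
  rw [e, interchange (mk (wires 1) ⊠ mk (Z 1 2 0)) (mk (Z 1 2 0) ⊠ (mk (Z 1 2 0) ⊠ mk (Z 1 2 0))) (mk (wires 1)) (mk (Z 1 2 0)),
    id_seq, interchange (mk (wires 1)) (mk (Z 1 2 0)) (mk (Z 1 2 0)) (mk (Z 1 2 0) ⊠ mk (Z 1 2 0)), id_seq, Z_split_seq_splits]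

/-- **Fusing the centre red node**: `((X^{(2,1)} ⊗ X^{(2,1)}) ⊗ (X^{(2,1)} ⊗ X^{(2,1)})) ⨾ ((𝕀 ⊗ X^{(2,1)}) ⊗ 𝕀)
= (X^{(2,1)} ⊗ X^{(4,1)}) ⊗ X^{(2,1)}`. [cite: JeandelPerdrixVilmart2018, Fig. 1 (S1)] -/
theorem xmerges_seq_bottom :
    ((mk (X 2 1 0) ⊠ mk (X 2 1 0)) ⊠ (mk (X 2 1 0) ⊠ mk (X 2 1 0))) ⨟ ((mk (wires 1) ⊠ mk (X 2 1 0)) ⊠ mk (wires 1)) =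
      (mk (X 2 1 0) ⊠ mk (X 4 1 0)) ⊠ mk (X 2 1 0) := by
  have h := congrArg (fun A => (transpose A).colorSwap) top_seq_splits
  simpa using h

/-! ### Step 2b: the double edge in the middle -/

/-- Three layers on `3 + k + 3` wires whose outer blocks are a permutation layer between wires:
`(𝕀³ ⊗ A ⊗ 𝕀³) ⨾ (P ⊗ 𝕀² ⊗ Q) ⨾ (𝕀³ ⊗ C ⊗ 𝕀³) = P ⊗ (A ⨾ C) ⊗ Q`. [folklore] -/
theorem conj_middle (P Q : ZXClass 3 3) (A : ZXClass 1 2) (C : ZXClass 2 1) :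
    ((mk (wires 3) ⊠ A) ⊠ mk (wires 3)) ⨟ ((P ⊠ mk (wires 2)) ⊠ Q) ⨟ ((mk (wires 3) ⊠ C) ⊠ mk (wires 3)) =
      (P ⊠ (A ⨟ C)) ⊠ Q := by
  rw [interchange (mk (wires 3) ⊠ A) (P ⊠ mk (wires 2)) (mk (wires 3)) Q, id_seq,
    interchange (mk (wires 3)) P A (mk (wires 2)), id_seq, seq_id,
    interchange (P ⊠ A) (mk (wires 3) ⊠ C) Q (mk (wires 3)), seq_id, interchange P (mk (wires 3)) A C, seq_id]

/-- The permutation layer of `B ⊗ B` regrouped around the middle pair of wires: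
`((𝕀 ⊗ σ) ⊗ 𝕀) ⊗ ((𝕀 ⊗ σ) ⊗ 𝕀) = ((𝕀 ⊗ σ) ⊗ 𝕀²) ⊗ (σ ⊗ 𝕀)`. [folklore] -/
theorem swaps_layer_regroup :
    ((mk (wires 1) ⊠ mk swap) ⊠ mk (wires 1)) ⊠ ((mk (wires 1) ⊠ mk swap) ⊠ mk (wires 1)) =
      ((mk (wires 1) ⊠ mk swap) ⊠ mk (wires 2)) ⊠ (mk swap ⊠ mk (wires 1)) := by
  rw [show (mk (wires 1) ⊠ mk swap) ⊠ mk (wires 1) = mk (wires 1) ⊠ (mk swap ⊠ mk (wires 1)) from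
      (par_assoc _ _ _).trans (cast_id _ _ _),
    show (mk (wires 1) ⊠ (mk swap ⊠ mk (wires 1))) ⊠ (mk (wires 1) ⊠ (mk swap ⊠ mk (wires 1))) =
      ((mk (wires 1) ⊠ (mk swap ⊠ mk (wires 1))) ⊠ mk (wires 1)) ⊠ (mk swap ⊠ mk (wires 1)) from
      (par_assoc' _ _ _).trans (cast_id _ _ _),
    show (mk (wires 1) ⊠ (mk swap ⊠ mk (wires 1))) ⊠ mk (wires 1) = mk (wires 1) ⊠ ((mk swap ⊠ mk (wires 1)) ⊠ mk (wires 1)) from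
      (par_assoc _ _ _).trans (cast_id _ _ _),
    show (mk swap ⊠ mk (wires 1)) ⊠ mk (wires 1) = mk swap ⊠ (mk (wires 1) ⊠ mk (wires 1)) from
      (par_assoc _ _ _).trans (cast_id _ _ _), wires_par_wires,
    show mk (wires 1) ⊠ (mk swap ⊠ mk (wires (1 + 1))) = (mk (wires 1) ⊠ mk swap) ⊠ mk (wires 2) from
      (par_assoc' _ _ _).trans (cast_id _ _ _)]

/-- Regrouping `𝕀³ ⊗ A ⊗ 𝕀³` as `𝕀² ⊗ (𝕀 ⊗ A ⊗ 𝕀) ⊗ 𝕀²`, for a split `A : 1 → 2`. [folklore] -/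
theorem wires_three_par_split_par_wires_three (A : ZXClass 1 2) :
    (mk (wires 3) ⊠ A) ⊠ mk (wires 3) = (mk (wires 2) ⊠ ((mk (wires 1) ⊠ A) ⊠ mk (wires 1))) ⊠ mk (wires 2) := by
  rw [show mk (wires 3) = mk (wires 2) ⊠ mk (wires 1) from (wires_par_wires 2 1).symm]
  nth_rw 2 [show mk (wires 2) ⊠ mk (wires 1) = mk (wires 1) ⊠ mk (wires 2) from
    (wires_par_wires 2 1).trans (wires_par_wires 1 2).symm]
  rw [par_assoc', cast_id, par_assoc (mk (wires 2)) (mk (wires 1)) A, cast_id, par_assoc (mk (wires 2)) (mk (wires 1) ⊠ A) (mk (wires 1)),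
    cast_id]

/-- The same regrouping for an effect `A : 1 → 0`. [folklore] -/
theorem wires_three_par_effect_par_wires_three (A : ZXClass 1 0) :
    (mk (wires 3) ⊠ A) ⊠ mk (wires 3) = (mk (wires 2) ⊠ ((mk (wires 1) ⊠ A) ⊠ mk (wires 1))) ⊠ mk (wires 2) := by
  rw [show mk (wires 3) = mk (wires 2) ⊠ mk (wires 1) from (wires_par_wires 2 1).symm]
  nth_rw 2 [show mk (wires 2) ⊠ mk (wires 1) = mk (wires 1) ⊠ mk (wires 2) from
    (wires_par_wires 2 1).trans (wires_par_wires 1 2).symm]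
  rw [par_assoc', cast_id, par_assoc (mk (wires 2)) (mk (wires 1)) A, cast_id, par_assoc (mk (wires 2)) (mk (wires 1) ⊠ A) (mk (wires 1)),
    cast_id]

/-- **Un-fusing the middle pair of legs of the centre green node**:
`(Z^{(1,2)} ⊗ Z^{(1,4)}) ⊗ Z^{(1,2)} = ((Z^{(1,2)} ⊗ Z^{(1,3)}) ⊗ Z^{(1,2)}) ⨾ (𝕀³ ⊗ Z^{(1,2)} ⊗ 𝕀³)`.
[cite: JeandelPerdrixVilmart2018, Fig. 1 (S1)] -/
theorem greens_unfuse :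
    (mk (Z 1 2 0) ⊠ mk (Z 1 4 0)) ⊠ mk (Z 1 2 0) =
      ((mk (Z 1 2 0) ⊠ mk (Z 1 3 0)) ⊠ mk (Z 1 2 0)) ⨟ ((mk (wires 3) ⊠ mk (Z 1 2 0)) ⊠ mk (wires 3)) := by
  have h14 : mk (Z 1 3 0) ⨟ ((mk (wires 1) ⊠ mk (Z 1 2 0)) ⊠ mk (wires 1)) = mk (Z 1 4 0) := by
    rw [show mk (Z 1 3 0) = mk (Z 1 2 0) ⨟ (mk (Z 1 2 0) ⊠ mk (wires 1)) from by rw [Z_seq_Z_par 1 1 1 2 le_rfl, add_zero],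
      seq_assoc, ← seq_par_wires, Z_seq_par_Z 1 1 1 2 le_rfl, add_zero,
      show mk (Z 1 (1 + 2) 0) ⊠ mk (wires 1) = mk (Z 1 3 0) ⊠ mk (wires 1) from rfl, Z_seq_Z_par 1 1 1 3 le_rfl, add_zero]
  rw [wires_three_par_split_par_wires_three,
    interchange (mk (Z 1 2 0) ⊠ mk (Z 1 3 0)) (mk (wires 2) ⊠ ((mk (wires 1) ⊠ mk (Z 1 2 0)) ⊠ mk (wires 1))) (mk (Z 1 2 0)) (mk (wires 2)),
    seq_id, interchange (mk (Z 1 2 0)) (mk (wires 2)) (mk (Z 1 3 0)) ((mk (wires 1) ⊠ mk (Z 1 2 0)) ⊠ mk (wires 1)), seq_id, h14]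

/-- **Un-fusing the middle pair of legs of the centre red node** (upside-down colour swap of
`greens_unfuse`). [cite: JeandelPerdrixVilmart2018, Fig. 1 (S1)] -/
theorem reds_unfuse :
    (mk (X 2 1 0) ⊠ mk (X 4 1 0)) ⊠ mk (X 2 1 0) =
      ((mk (wires 3) ⊠ mk (X 2 1 0)) ⊠ mk (wires 3)) ⨟ ((mk (X 2 1 0) ⊠ mk (X 3 1 0)) ⊠ mk (X 2 1 0)) := by
  have h := congrArg (fun A => (transpose A).colorSwap) greens_unfuse
  simpa using h

/-! ### Step 2c: the Hopf law on the double edge, and deleting the dangling legs -/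

/-- `t ⊗ 𝕀³ = 𝕀³ ⊗ t` for a scalar `t`. [folklore] -/
theorem scalar_par_wires_three (t : ZXClass 0 0) : t ⊠ mk (wires 3) = mk (wires 3) ⊠ t := by
  rw [show mk (wires 3) = mk (wires 2) ⊠ mk (wires 1) from (wires_par_wires 2 1).symm, par_assoc', cast_id,
    scalar_par_wires_two, par_assoc, cast_id, scalar_par_wires]
  exact (par_assoc' _ _ _).trans (cast_id _ _ _)

/-- A scalar commutes past a `3 → 3` map. [folklore] -/
theorem scalar_par_three_three_comm (t : ZXClass 0 0) (A : ZXClass 3 3) : t ⊠ A = A ⊠ t := by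
  calc t ⊠ A = (t ⊠ mk (wires 3)) ⨟ (mk (wires 0) ⊠ A) := by rw [par_eq_seq_left]
    _ = (mk (wires 3) ⊠ t) ⨟ (mk (wires 0) ⊠ A) := by rw [scalar_par_wires_three]
    _ = A ⊠ t := by rw [empty_par, cast_id, par_eq_seq_right A t, par_empty]

/-- A scalar passes a `3 → 7` map (instance of `scalar_par_seq_right`). [folklore] -/
theorem three_seven_seq_scalar_par (G : ZXClass 3 7) (s : ZXClass 0 0) (Y : ZXClass 7 7) :
    G ⨟ (s ⊠ Y) = s ⊠ (G ⨟ Y) := by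
  rw [scalar_par_seq_right, empty_par, cast_id]

/-- A scalar in front of a `3 → 7` map stays in front (instance of `scalar_par_seq_left`). [folklore] -/
theorem scalar_par_three_seven_seq (s : ZXClass 0 0) (A : ZXClass 3 7) (R : ZXClass 7 3) :
    (s ⊠ A) ⨟ R = s ⊠ (A ⨟ R) := by
  rw [scalar_par_seq_left, empty_par, cast_id]

/-- A scalar enters the middle of `G ⨾ Y ⨾ R` (`3 → 7 → 7 → 3` wires). [folklore] -/
theorem scalar_par_three_seven_seven_three (s : ZXClass 0 0) (G : ZXClass 3 7) (Y : ZXClass 7 7) (R : ZXClass 7 3) :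
    s ⊠ ((G ⨟ Y) ⨟ R) = (G ⨟ (s ⊠ Y)) ⨟ R := by
  rw [three_seven_seq_scalar_par, scalar_par_three_seven_seq]

/-- A scalar enters the middle block of `(P ⊗ Y) ⊗ Q`. [folklore] -/
theorem scalar_par_blocks (s : ZXClass 0 0) (P Q : ZXClass 3 3) (Y : ZXClass 1 1) :
    s ⊠ ((P ⊠ Y) ⊠ Q) = (P ⊠ (s ⊠ Y)) ⊠ Q := by
  rw [par_assoc' s (P ⊠ Y) Q, cast_id, par_assoc' s P Y, cast_id, scalar_par_three_three_comm s P, par_assoc P s Y, cast_id]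

/-- An effect followed by a state in the middle block, as three layers:
`(P ⊗ (E ⨾ St)) ⊗ Q = (𝕀³ ⊗ E ⊗ 𝕀³) ⨾ (P ⊗ Q) ⨾ (𝕀³ ⊗ St ⊗ 𝕀³)`. [folklore] -/
theorem effect_state_middle (P Q : ZXClass 3 3) (E : ZXClass 1 0) (St : ZXClass 0 1) :
    (P ⊠ (E ⨟ St)) ⊠ Q = ((mk (wires 3) ⊠ E) ⊠ mk (wires 3)) ⨟ (P ⊠ Q) ⨟ ((mk (wires 3) ⊠ St) ⊠ mk (wires 3)) := by
  have h1 : (mk (wires 3) ⊠ E) ⨟ (P ⊠ St) = P ⊠ (E ⨟ St) := by rw [interchange, id_seq]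
  have h2 : (P ⊠ mk (wires 0)) ⨟ (mk (wires 3) ⊠ St) = P ⊠ St := by rw [interchange, seq_id, id_seq]
  conv_lhs => rw [← h1, ← id_seq Q, ← interchange (mk (wires 3) ⊠ E) (P ⊠ St) (mk (wires 3)) Q, ← h2, ← seq_id Q,
    ← interchange (P ⊠ mk (wires 0)) (mk (wires 3) ⊠ St) Q (mk (wires 3)), par_empty, ← seq_assoc]

/-- **Deleting the dangling green leg**: `((Z^{(1,2)} ⊗ Z^{(1,3)}) ⊗ Z^{(1,2)}) ⨾ (𝕀³ ⊗ Z^{(1,0)} ⊗ 𝕀³) = (Z^{(1,2)} ⊗ Z^{(1,2)}) ⊗ Z^{(1,2)}`.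
[cite: JeandelPerdrixVilmart2018, Fig. 1 (S1)] -/
theorem greens_delete :
    ((mk (Z 1 2 0) ⊠ mk (Z 1 3 0)) ⊠ mk (Z 1 2 0)) ⨟ ((mk (wires 3) ⊠ mk (Z 1 0 0)) ⊠ mk (wires 3)) =
      (mk (Z 1 2 0) ⊠ mk (Z 1 2 0)) ⊠ mk (Z 1 2 0) := by
  have h12 : mk (Z 1 3 0) ⨟ ((mk (wires 1) ⊠ mk (Z 1 0 0)) ⊠ mk (wires 1)) = mk (Z 1 2 0) := by
    rw [show mk (Z 1 3 0) = mk (Z 1 2 0) ⨟ (mk (Z 1 2 0) ⊠ mk (wires 1)) from by rw [Z_seq_Z_par 1 1 1 2 le_rfl, add_zero],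
      seq_assoc, ← seq_par_wires, Z_seq_par_Z 1 1 1 0 le_rfl, add_zero (0 : ZMod 8),
      show mk (Z 1 (1 + 0) 0) = mk (wires 1) from Z_one_one, wires_par_wires, seq_id]
  rw [wires_three_par_effect_par_wires_three,
    interchange (mk (Z 1 2 0) ⊠ mk (Z 1 3 0)) (mk (wires 2) ⊠ ((mk (wires 1) ⊠ mk (Z 1 0 0)) ⊠ mk (wires 1))) (mk (Z 1 2 0)) (mk (wires 2)),
    seq_id, interchange (mk (Z 1 2 0)) (mk (wires 2)) (mk (Z 1 3 0)) ((mk (wires 1) ⊠ mk (Z 1 0 0)) ⊠ mk (wires 1)), seq_id, h12]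

/-- **Deleting the dangling red leg** (upside-down colour swap of `greens_delete`). [cite: JeandelPerdrixVilmart2018, Fig. 1 (S1)] -/
theorem reds_delete :
    ((mk (wires 3) ⊠ mk (X 0 1 0)) ⊠ mk (wires 3)) ⨟ ((mk (X 2 1 0) ⊠ mk (X 3 1 0)) ⊠ mk (X 2 1 0)) =
      (mk (X 2 1 0) ⊠ mk (X 2 1 0)) ⊠ mk (X 2 1 0) := by
  have h := congrArg (fun A => (transpose A).colorSwap) greens_delete
  simpa using h

/-! ### JPV Lemma 11 -/

/-- **JPV Lemma 11 (the 6-cycle bialgebra)**: the alternating hexagon with inputs on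
`red, green, red` and outputs on `green, red, green` equals the alternating crown with inputs on
the three green and outputs on the three red nodes:
`((𝕀 ⊗ Z^{(1,2)}) ⊗ 𝕀) ⨾ (X^{(2,1)} ⊗ X^{(2,1)}) ⨾ (Z^{(1,2)} ⊗ Z^{(1,2)}) ⨾ ((𝕀 ⊗ X^{(2,1)}) ⊗ 𝕀)
 = ((Z^{(1,2)} ⊗ Z^{(1,2)}) ⊗ Z^{(1,2)}) ⨾ ((𝕀 ⊗ σ) ⊗ (σ ⊗ 𝕀)) ⨾ ((X^{(2,1)} ⊗ X^{(2,1)}) ⊗ X^{(2,1)})`.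
Derivation (JPV's figure read backwards): (B2) twice, fusion of the centre nodes, the Hopf law on
the resulting double edge (consuming the `√2 ⊗ √2`), deletion of the two dangling legs.
[cite: JeandelPerdrixVilmart2018, Appendix Lemma 11] -/
theorem hexagon_bialgebra :
    ((mk (wires 1) ⊠ mk (Z 1 2 0)) ⊠ mk (wires 1)) ⨟ (mk (X 2 1 0) ⊠ mk (X 2 1 0)) ⨟ (mk (Z 1 2 0) ⊠ mk (Z 1 2 0)) ⨟
        ((mk (wires 1) ⊠ mk (X 2 1 0)) ⊠ mk (wires 1)) =
      ((mk (Z 1 2 0) ⊠ mk (Z 1 2 0)) ⊠ mk (Z 1 2 0)) ⨟ ((mk (wires 1) ⊠ mk swap) ⊠ (mk swap ⊠ mk (wires 1))) ⨟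
        ((mk (X 2 1 0) ⊠ mk (X 2 1 0)) ⊠ mk (X 2 1 0)) := by
  set Zg := mk (Z 1 2 0) ⊠ mk (Z 1 2 0) with hZg
  set S := (mk (wires 1) ⊠ mk swap) ⊠ mk (wires 1) with hS
  set Xr := mk (X 2 1 0) ⊠ mk (X 2 1 0) with hXr
  rw [hexagon_lhs_eq_sqrt_two_sq_par, ← hZg, ← hS, ← hXr,
    ← interchange (Zg ⨟ S) Xr (Zg ⨟ S) Xr, ← interchange Zg S Zg S,
    ← seq_assoc ((mk (wires 1) ⊠ mk (Z 1 2 0)) ⊠ mk (wires 1)) ((Zg ⊠ Zg) ⨟ (S ⊠ S)) (Xr ⊠ Xr),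
    ← seq_assoc ((mk (wires 1) ⊠ mk (Z 1 2 0)) ⊠ mk (wires 1)) (Zg ⊠ Zg) (S ⊠ S),
    seq_assoc _ (Xr ⊠ Xr) ((mk (wires 1) ⊠ mk (X 2 1 0)) ⊠ mk (wires 1)), hZg, top_seq_splits, hXr, xmerges_seq_bottom, hS,
    swaps_layer_regroup, greens_unfuse, reds_unfuse]
  set G := (mk (Z 1 2 0) ⊠ mk (Z 1 3 0)) ⊠ mk (Z 1 2 0) with hG
  set R := (mk (X 2 1 0) ⊠ mk (X 3 1 0)) ⊠ mk (X 2 1 0) with hR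
  set P := mk (wires 1) ⊠ mk swap with hP
  set Q := mk swap ⊠ mk (wires 1) with hQ
  rw [← seq_assoc _ ((mk (wires 3) ⊠ mk (X 2 1 0)) ⊠ mk (wires 3)) R, seq_assoc G, seq_assoc G, conj_middle,
    scalar_par_three_seven_seven_three, scalar_par_three_seven_seven_three, scalar_par_blocks, scalar_par_blocks,
    hopf_transpose, effect_state_middle, ← seq_assoc G, ← seq_assoc G, greens_delete, seq_assoc _ _ R, reds_delete, hP, hQ]

end ZXClass

end Literature.Computability.QuantumComplexity
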